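import Literature.MathematicalPhysics.QuantumFieldTheory.Balaban1983to89.B1Eq324BenfattoSect5Eq534
import Literature.MathematicalPhysics.QuantumFieldTheory.Balaban1983to89.B1Eq324BenfattoTranslation
import HarnessLib

/-!
# `Balaban1983to89.B1Eq324BenfattoSect5Iteration` — [BenfattoEtAl1978] §5 p. 159, «the same structure as (5.12) with J replaced by Γ̄₁ and b by γb …
# choosing a new pavement Q′^b displaced by b²/2»: the two bookkeeping facts of the ITERATION — RESTRICTING the coefficient family to `Γ̄₁` and
# TRANSLATING the whole datum `(J, I, A)` by the displacement keep the form (4.5)/(4.7) with the same `s, D, ϰ` and the same coefficient bound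

statement-level skeleton of published theorems with citation tags; proofs where landed; nothing here is a claim about the
Yang–Mills mass gap

WHY THIS MODULE (cell `pub-ymgap`, seat `dag-n08-d` gen 9, INTENT-30; node N08 [Balaban1985UV3]; the [BenfattoEtAl1978] source chain behind the
(α)-row `h324c`; layer 3 «pavement iteration» of the assembly census `N08-BCG-ASSEMBLY-MAP.md` v1 item (4)).  Print, p. 159 (render
`lit-balaban-typer/renders/benfatto1978-cmp59/bcg_p159_s3.png`, read first-hand): *"Now we study the integral and remark that it has the same structure as
(5.12) with J replaced by Γ̄₁ and b by γb. Therefore we can proceed as before choosing a new pavement Q′^b displaced by b²/2 with respect to Q^b obtaining a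
result similar to (5.31) with Γ̄₁ replaced by a new set Γ̄′₁ (much smaller than Γ̄₁). Again one proceeds as before by choosing a third pavement Q″^b
displaced by b²/4 with respect to Q′^b and, if d = 3, a fourth one displaced by b²/16 w.r.t. Q″^b."*  The structural theorems of this seat's §5 modules
(`…Sect5Boxes` … `…Sect5Eq535`) are stated for the standard pavement `Lℤ^d` (tesserae `box L m`); this file supplies (§2) the translation that moves a
displaced pavement back to the standard one — the free field is translation invariant (`…Translation.P0_map_translate`) — and (§1) the restriction that
makes `∫ Π_Δχ̂^{γb}_Δ e^{H^A_{Γ̄₁}} dP̂₀` (the output of `…Sect5Eq535`) literally the left side of (4.7) for the datum `(J ∩ Γ̄₁, I, A|_{Γ̄₁}, γb)`.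

WHAT IS PROVED (standard axioms; no `sorry`; definition lane for the two plumbing definitions `restrictCoef`, `shiftCoef`).
* §1 RESTRICTION: `restrictCoef a R` (`A^{n}_{Δ}·1[all Δ_i ∈ R]`), `coefSupportedIn_restrictCoef` (supported in `J ∩ R` when `A` is supported in `J`),
  `abs_restrictCoef_le`, `tuplesIn_inter_eq`, `hamiltonian_inter_eq` (`H^A_R = H^A_{R∩J}` under the extension convention), `hamiltonian_restrictCoef`
  (`H^{A|R}_T = H^A_T` for `T ⊆ R`), ★ `cutoffBoltzmann_hamiltonian_eq_restrict` (`Π_Δχ̂^{c}_Δ e^{H^A_R} = cutoffBoltzmann (hamiltonian s D ϰ (A|_R) (J ∩ R)) I c`: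
  the next step's datum, `J ∩ R ⊆ I`, supported family, same bound).
* §2 TRANSLATION: `shiftCoef a σ` (`(p, Δ, n) ↦ A^{n}_{Δ+σ}`), `imageAddEquiv` (`R ≃ R + σ`), ★ `hamiltonian_translate`
  (`H^A_{R+σ}(z) = H^{shiftCoef A σ}_R(z ∘ (· + σ))`, reindexing + `…Translation.connLength_add_right`), `coefSupportedIn_shiftCoef`, `abs_shiftCoef_le`,
  `cutoffBoltzmann_translate`, ★★ `integral_cutoffBoltzmann_translate`
  (`∫ cutoffBoltzmann (H^A_{J+σ}) (I+σ) b dP̂₀ = ∫ cutoffBoltzmann (H^{shiftCoef A σ}_J) I b dP̂₀`, `…Translation.integral_P0_comp_translate` +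
  `mem_smallFieldSet_translate_iff`).
HONEST SCOPE.  Bookkeeping only; the error collection over the `d + 1` steps, the cumulant exponents of (5.35) and `b*` are NOT here; count-neutral for
N08; `BasicLemmaPrinted` NOT discharged; nothing about d = 4, the continuum, OS axioms, a mass gap or the Clay problem.
-/

noncomputable section

open Finset MeasureTheory
open scoped BigOperators

namespace Literature.MathematicalPhysics.QuantumFieldTheory.Balaban1983to89.B1Eq324BenfattoSect5Iteration

open _root_.MeasureTheory
open Literature.MathematicalPhysics.QuantumFieldTheory.Balaban1983to89.B1Eq324BenfattoLemma
open Literature.MathematicalPhysics.QuantumFieldTheory.Balaban1983to89.B1Eq324BenfattoSect5Boxes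
open Literature.MathematicalPhysics.QuantumFieldTheory.Balaban1983to89.B1Eq324BenfattoSect5Eq511
open Literature.MathematicalPhysics.QuantumFieldTheory.Balaban1983to89.B1Eq324BenfattoTranslation

variable {d : ℕ}

/-! ## §1  Restriction: `J` replaced by `J ∩ Γ̄₁`, the coefficient family by its restriction -/

section Restrict

/-- **The coefficient family restricted to a region**: `A^{n}_{Δ}` if every `Δ_i ∈ R`, else `0` — the family of the Hamiltonian `H_{Γ̄₁}` read as an
instance of (4.5) on `J ∩ Γ̄₁`. [cite: BenfattoEtAl1978, (4.5) p.152, (5.35) p.159] -/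
def restrictCoef (a : Coef d) (R : Finset (B1Eq324BenfattoLemma.Site d)) : Coef d :=
  fun p Δ n => if ∀ i, Δ i ∈ R then a p Δ n else 0

variable {s D : ℕ} {κ : ℝ} {a : Coef d} {J R : Finset (B1Eq324BenfattoLemma.Site d)}

/-- The restricted family is supported in `J ∩ R`. [cite: BenfattoEtAl1978, (5.5) p.154] -/
theorem coefSupportedIn_restrictCoef (hJ : CoefSupportedIn a J) (R : Finset (B1Eq324BenfattoLemma.Site d)) :
    CoefSupportedIn (restrictCoef a R) (J ∩ R) := by
  intro p Δ n hΔ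
  obtain ⟨i, hi⟩ := hΔ
  rw [Finset.mem_inter, not_and_or] at hi
  simp only [restrictCoef]
  rcases hi with hJ' | hR'
  · split_ifs
    · exact hJ p Δ n ⟨i, hJ'⟩
    · rfl
  · rw [if_neg (fun h => hR' (h i))]

/-- The restricted family obeys the same bound. [cite: BenfattoEtAl1978, (4.5) p.152] -/
theorem abs_restrictCoef_le (a : Coef d) (R : Finset (B1Eq324BenfattoLemma.Site d)) (p : ℕ) (Δ : Fin p → B1Eq324BenfattoLemma.Site d)
    (n : Fin p → ℕ) : |restrictCoef a R p Δ n| ≤ |a p Δ n| := by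
  simp only [restrictCoef]
  split_ifs
  · exact le_rfl
  · rw [abs_zero]
    exact abs_nonneg _

/-- `J`-tuples inside `R ∩ J` are the `J`-tuples inside `R`. [cite: BenfattoEtAl1978, (5.5) p.154] -/
theorem tuplesIn_inter_eq (p : ℕ) : tuplesIn J p (R ∩ J) = tuplesIn J p R := by
  ext Δ
  simp only [mem_tuplesIn, Finset.mem_inter]
  exact ⟨fun h i => (h i).1, fun h i => ⟨h i, (Δ i).2⟩⟩

/-- **Under the extension convention `H^A_R = H^A_{R ∩ J}`** (coefficients vanish off `J`). [cite: BenfattoEtAl1978, (5.5) p.154] -/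
theorem hamiltonian_inter_eq (hJ : CoefSupportedIn a J) (R : Finset (B1Eq324BenfattoLemma.Site d)) (z : B1Eq324BenfattoLemma.Site d → ℝ) :
    hamiltonian s D κ a R z = hamiltonian s D κ a (R ∩ J) z := by
  rw [hamiltonian_eq_sum_tuplesIn hJ, hamiltonian_eq_sum_tuplesIn hJ]
  simp only [tuplesIn_inter_eq]

/-- **`H^{A|_R}_T = H^A_T` for `T ⊆ R`** (every tuple of `T` lies in `R`). [cite: BenfattoEtAl1978, (4.5) p.152] -/
theorem hamiltonian_restrictCoef {T : Finset (B1Eq324BenfattoLemma.Site d)} (hT : T ⊆ R) (z : B1Eq324BenfattoLemma.Site d → ℝ) :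
    hamiltonian s D κ (restrictCoef a R) T z = hamiltonian s D κ a T z := by
  unfold hamiltonian
  refine Finset.sum_congr rfl fun p _ => Finset.sum_congr rfl fun Δ _ => Finset.sum_congr rfl fun n _ => ?_
  simp only [restrictCoef, if_pos (fun i => hT (Δ i).2)]

/-- **«THE SAME STRUCTURE AS (5.12) WITH J REPLACED BY Γ̄₁ AND b BY γb»**: for `A` supported in `J ⊆ I` and any region `R` (print: `R = Γ̄₁`),
`Π_Δχ̂^{c}_Δ e^{H^A_R} = cutoffBoltzmann (hamiltonian s D ϰ (restrictCoef A R) (J ∩ R)) I c` pointwise — the left side of (4.7) for the datum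
`(J′ = J ∩ R ⊆ I, A′ = A|_R supported in J′ with the same bound, b′ = c)`. [cite: BenfattoEtAl1978, (5.35) p.159] -/
theorem cutoffBoltzmann_hamiltonian_eq_restrict (hJ : CoefSupportedIn a J) (R I : Finset (B1Eq324BenfattoLemma.Site d)) (c : ℝ)
    (z : B1Eq324BenfattoLemma.Site d → ℝ) :
    cutoffBoltzmann (hamiltonian s D κ a R) I c z = cutoffBoltzmann (hamiltonian s D κ (restrictCoef a R) (J ∩ R)) I c z := by
  simp only [cutoffBoltzmann]
  by_cases hz : z ∈ smallFieldSet I c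
  · rw [Set.indicator_of_mem hz, Set.indicator_of_mem hz, hamiltonian_inter_eq hJ R z, Finset.inter_comm,
      hamiltonian_restrictCoef Finset.inter_subset_right]
  · rw [Set.indicator_of_notMem hz, Set.indicator_of_notMem hz]

end Restrict

/-! ## §2  Translation: a displaced pavement is the standard pavement for the translated datum -/

section Translate

/-- **The coefficient family read at shifted tuples**: `(shiftCoef A σ)^{n}_{Δ} = A^{n}_{Δ+σ}`. [cite: BenfattoEtAl1978, (4.5) p.152, p.159] -/
def shiftCoef (a : Coef d) (σ : B1Eq324BenfattoLemma.Site d) : Coef d :=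
  fun p Δ n => a p (fun i => Δ i + σ) n

variable {s D : ℕ} {κ : ℝ} {a : Coef d}

/-- The shifted family obeys the same bound (pointwise it IS a value of `A`). [cite: BenfattoEtAl1978, (4.5) p.152] -/
theorem abs_shiftCoef_le {A : ℝ} (hA : ∀ (p : ℕ) (Δ : Fin p → B1Eq324BenfattoLemma.Site d) (n : Fin p → ℕ), |a p Δ n| ≤ A)
    (σ : B1Eq324BenfattoLemma.Site d) (p : ℕ) (Δ : Fin p → B1Eq324BenfattoLemma.Site d) (n : Fin p → ℕ) : |shiftCoef a σ p Δ n| ≤ A :=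
  hA p _ n

/-- The shifted family is supported in `J` iff … — precisely: if `A` is supported in `J + σ` then `shiftCoef A σ` is supported in `J`.
[cite: BenfattoEtAl1978, (5.5) p.154] -/
theorem coefSupportedIn_shiftCoef {J : Finset (B1Eq324BenfattoLemma.Site d)} (σ : B1Eq324BenfattoLemma.Site d)
    (hJ : CoefSupportedIn a (J.image fun x => x + σ)) : CoefSupportedIn (shiftCoef a σ) J := by
  intro p Δ n hΔ
  obtain ⟨i, hi⟩ := hΔ
  simp only [shiftCoef]
  refine hJ p _ n ⟨i, fun h => hi ?_⟩
  rw [Finset.mem_image] at h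
  obtain ⟨x, hx, hxe⟩ := h
  have : x = Δ i := by
    have := congrArg (fun y => y - σ) hxe
    simpa using this
  exact this ▸ hx

/-- **`R ≃ R + σ`**: translating a region is a bijection onto its image. [folklore] [cite: BenfattoEtAl1978, p.159] -/
def imageAddEquiv (R : Finset (B1Eq324BenfattoLemma.Site d)) (σ : B1Eq324BenfattoLemma.Site d) :
    R ≃ (R.image fun x => x + σ) where
  toFun x := ⟨(x : B1Eq324BenfattoLemma.Site d) + σ, Finset.mem_image_of_mem _ x.2⟩
  invFun y := ⟨(y : B1Eq324BenfattoLemma.Site d) - σ, by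
    obtain ⟨x, hx, hxe⟩ := Finset.mem_image.mp y.2
    rw [← hxe, add_sub_cancel_right]
    exact hx⟩
  left_inv x := by
    ext1
    exact add_sub_cancel_right _ _
  right_inv y := by
    ext1
    exact sub_add_cancel _ _

/-- **THE HAMILTONIAN OF A TRANSLATED REGION**: `H^A_{R+σ}(z) = H^{shiftCoef A σ}_R(z ∘ (· + σ))` — reindex the tuples of `R + σ` as shifted tuples of `R`
and use the translation invariance of the connecting length `d(Δ₁…Δ_p)` (`…Translation.connLength_add_right`). [cite: BenfattoEtAl1978, (4.5) p.152, p.159] -/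
theorem hamiltonian_translate (R : Finset (B1Eq324BenfattoLemma.Site d)) (σ : B1Eq324BenfattoLemma.Site d) (z : B1Eq324BenfattoLemma.Site d → ℝ) :
    hamiltonian s D κ a (R.image fun x => x + σ) z = hamiltonian s D κ (shiftCoef a σ) R fun x => z (x + σ) := by
  unfold hamiltonian
  refine Finset.sum_congr rfl fun p _ => ?_
  -- reindex `Fin p → R + σ` by `Fin p → R`
  refine (Fintype.sum_equiv ((Equiv.refl (Fin p)).arrowCongr (imageAddEquiv R σ))
    (fun Δ' : Fin p → R => ∑ n ∈ admissible p D, shiftCoef a σ p (fun i => (Δ' i : B1Eq324BenfattoLemma.Site d)) n *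
        Real.exp (-(κ / 2) * connLength fun i => (Δ' i : B1Eq324BenfattoLemma.Site d)) *
          ∏ i, (fun x => z (x + σ)) (Δ' i : B1Eq324BenfattoLemma.Site d) ^ n i)
    (fun Δ => ∑ n ∈ admissible p D, a p (fun i => (Δ i : B1Eq324BenfattoLemma.Site d)) n *
        Real.exp (-(κ / 2) * connLength fun i => (Δ i : B1Eq324BenfattoLemma.Site d)) * ∏ i, z (Δ i : B1Eq324BenfattoLemma.Site d) ^ n i)
    fun Δ' => ?_).symm
  have key : ∀ i, ((((Equiv.refl (Fin p)).arrowCongr (imageAddEquiv R σ)) Δ' i : (R.image fun x => x + σ)) : B1Eq324BenfattoLemma.Site d)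
      = (Δ' i : B1Eq324BenfattoLemma.Site d) + σ := fun _ => rfl
  simp only [key, shiftCoef, connLength_add_right]

variable {α β : ℝ}

/-- **The cut-off Boltzmann factor of a translated datum**: `(Π_Δχ̂^{I+σ}_Δ e^{H^A_{J+σ}})(z) = (Π_Δχ̂^{I}_Δ e^{H^{shiftCoef A σ}_J})(z ∘ (· + σ))`.
[cite: BenfattoEtAl1978, (4.7) p.152, p.159] -/
theorem cutoffBoltzmann_translate (J I : Finset (B1Eq324BenfattoLemma.Site d)) (b : ℝ) (σ : B1Eq324BenfattoLemma.Site d)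
    (z : B1Eq324BenfattoLemma.Site d → ℝ) :
    cutoffBoltzmann (hamiltonian s D κ a (J.image fun x => x + σ)) (I.image fun x => x + σ) b z =
      cutoffBoltzmann (hamiltonian s D κ (shiftCoef a σ) J) I b fun x => z (x + σ) := by
  simp only [cutoffBoltzmann]
  by_cases hz : z ∈ smallFieldSet (I.image fun x => x + σ) b
  · rw [Set.indicator_of_mem hz, Set.indicator_of_mem ((mem_smallFieldSet_translate_iff I b σ z).mpr hz), hamiltonian_translate]
  · rw [Set.indicator_of_notMem hz, Set.indicator_of_notMem (fun h => hz ((mem_smallFieldSet_translate_iff I b σ z).mp h))]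

/-- `Π_Δχ̂_Δ e^{H}` is measurable for every region Hamiltonian. [cite: BenfattoEtAl1978, (4.7) p.152] -/
theorem measurable_cutoffBoltzmann_hamiltonian (a : Coef d) (J I : Finset (B1Eq324BenfattoLemma.Site d)) (b : ℝ) :
    Measurable (cutoffBoltzmann (hamiltonian s D κ a J) I b) := by
  rw [cutoffBoltzmann]
  refine (Measurable.indicator ?_ (measurableSet_smallFieldSet I b))
  have hc : Continuous fun z : B1Eq324BenfattoLemma.Site d → ℝ => hamiltonian s D κ a J z := by
    unfold hamiltonian
    refine continuous_finsetSum _ fun p _ => continuous_finsetSum _ fun Δ _ => continuous_finsetSum _ fun n _ => ?_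
    exact continuous_const.mul (continuous_finsetProd _ fun i _ => (continuous_apply _).pow _)
  exact hc.measurable.exp

/-- **«WE CAN PROCEED AS BEFORE CHOOSING A NEW PAVEMENT DISPLACED BY b²/2»** — every step of the iteration may use the STANDARD pavement: the left
side of (4.7) for the datum `(J + σ, I + σ, A, b)` equals the one for `(J, I, shiftCoef A σ, b)`, by the translation invariance of `P̂₀`
(`…Translation.integral_P0_comp_translate`); so the corridor theorems of `…Sect5Boxes` … `…Sect5Eq535`, stated for tesserae cornered on `Lℤ^d`, apply to a
pavement displaced by `−σ` after translating the datum by `σ`. [cite: BenfattoEtAl1978, p.159] -/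
theorem integral_cutoffBoltzmann_translate (hα : 0 < α) (hβ : 0 < β) (J I : Finset (B1Eq324BenfattoLemma.Site d)) (b : ℝ)
    (σ : B1Eq324BenfattoLemma.Site d) :
    ∫ z, cutoffBoltzmann (hamiltonian s D κ a (J.image fun x => x + σ)) (I.image fun x => x + σ) b z ∂P0 d α β =
      ∫ z, cutoffBoltzmann (hamiltonian s D κ (shiftCoef a σ) J) I b z ∂P0 d α β := by
  simp only [cutoffBoltzmann_translate]
  exact integral_P0_comp_translate hα hβ σ (measurable_cutoffBoltzmann_hamiltonian (shiftCoef a σ) J I b)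

end Translate

/-! ## §3  (v1.1) The coefficient bounds in the RANGE form the corridor theorems consume (referee ref-G READ211 NIT-1) -/

section Range

variable {s D : ℕ} {a : Coef d} {J R : Finset (B1Eq324BenfattoLemma.Site d)} {A : ℝ}

/-- **The shifted family inherits the range-form bound**: if `|A^{n}_{Δ}| ≤ A` for the tuples of `J + σ` (degrees `1 ≤ p ≤ s`, admissible exponents),
then `|(shiftCoef A σ)^{n}_{Δ}| ≤ A` for the tuples of `J` — the hypothesis shape of `…Sect5Eq534`/`…Sect5Eq515`/`…Sect5PavementStep` after a
translation of the datum. [cite: BenfattoEtAl1978, (4.5) p.152, p.159] -/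
theorem abs_shiftCoef_le_of_range (σ : B1Eq324BenfattoLemma.Site d)
    (hA : ∀ p ∈ Finset.Icc 1 s, ∀ (Δ : Fin p → B1Eq324BenfattoLemma.Site d), (∀ i, Δ i ∈ J.image fun x => x + σ) →
      ∀ n ∈ admissible p D, |a p Δ n| ≤ A) :
    ∀ p ∈ Finset.Icc 1 s, ∀ (Δ : Fin p → B1Eq324BenfattoLemma.Site d), (∀ i, Δ i ∈ J) →
      ∀ n ∈ admissible p D, |shiftCoef a σ p Δ n| ≤ A :=
  fun p hp Δ hΔ n hn => hA p hp (fun i => Δ i + σ) (fun i => Finset.mem_image_of_mem _ (hΔ i)) n hn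

/-- **The restricted family inherits the range-form bound** on the tuples of `J ∩ R` (indeed of `J`). [cite: BenfattoEtAl1978, (4.5) p.152, p.159] -/
theorem abs_restrictCoef_le_of_range (R : Finset (B1Eq324BenfattoLemma.Site d))
    (hA : ∀ p ∈ Finset.Icc 1 s, ∀ (Δ : Fin p → B1Eq324BenfattoLemma.Site d), (∀ i, Δ i ∈ J) → ∀ n ∈ admissible p D, |a p Δ n| ≤ A) :
    ∀ p ∈ Finset.Icc 1 s, ∀ (Δ : Fin p → B1Eq324BenfattoLemma.Site d), (∀ i, Δ i ∈ J ∩ R) →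
      ∀ n ∈ admissible p D, |restrictCoef a R p Δ n| ≤ A :=
  fun p hp Δ hΔ n hn => (abs_restrictCoef_le a R p Δ n).trans (hA p hp Δ (fun i => (Finset.mem_inter.mp (hΔ i)).1) n hn)

/-- **The extension convention transports**: `A` is supported in `J + σ` iff `shiftCoef A σ` is supported in `J`.
[cite: BenfattoEtAl1978, (5.5) p.154, p.159] -/
theorem coefSupportedIn_shiftCoef_iff (σ : B1Eq324BenfattoLemma.Site d) :
    CoefSupportedIn (shiftCoef a σ) J ↔ CoefSupportedIn a (J.image fun x => x + σ) := by
  refine ⟨fun h p Δ n hΔ => ?_, coefSupportedIn_shiftCoef σ⟩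
  obtain ⟨i, hi⟩ := hΔ
  have key : shiftCoef a σ p (fun j => Δ j - σ) n = a p Δ n := by
    simp only [shiftCoef, sub_add_cancel]
  rw [← key]
  refine h p _ n ⟨i, fun hmem => hi ?_⟩
  have := Finset.mem_image_of_mem (fun x => x + σ) hmem
  simpa using this

end Range

end Literature.MathematicalPhysics.QuantumFieldTheory.Balaban1983to89.B1Eq324BenfattoSect5Iteration

end
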